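import Summits.Ventures.CertifiedManyBodySolver.Downfold.EmeryOrbitalWeightNode
import Summits.Ventures.CertifiedManyBodySolver.Downfold.EmeryOrbitalWeightFaceLever
import HarnessLib

/-!
# BOTH ENDS of the certified Fermi-surface Cu-d weight window move together under doping: the bracket lemma behind the census lever tables

Venture CertifiedManyBodySolver, cell `pub/hubbard-downfold` (stage S1; INFLATION-RULES-3to1-B §B.23 / §B.72 / §B.73), seat hubbard-downfold-mod-4 (technique B, g29);
namespace `Summit.Ventures.CertifiedManyBodySolver.Downfold.Emery`. Joins `EmeryOrbitalWeightNode` (`dWeightNode_strictAnti`: the NODAL Cu-d weight is strictly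
decreasing in the Fermi energy for every charge-transfer σ set) and `EmeryOrbitalWeightFaceLever` (`dWeightFace_strictAnti_of_check`: the ANTINODAL weight is strictly
decreasing on the face window, worded for whole ε_F brackets by the rational test `faceLeverCheck`). Everything PROVED (0 sorry). WHAT THIS IS NOT: a statement about any
material; `U = 0` one-body kinematics of the σ model as printed.

* `dwLever_of_brackets`: a σ point `(Δ, a, b, c) ∈ ℚ⁴`, a LOWER ε_F bracket `[e₁, e₂]` and a HIGHER one `[f₁, f₂]` with `e₂ < f₁` and `faceLeverCheck Δ a b c e₁ f₂` ⇒ for every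
  `ε₁ ∈ [e₁, e₂]`, `ε₂ ∈ [f₁, f₂]`: `ε₁ < ε₂`, `w_node(ε₂) < w_node(ε₁)` and `w_face(ε₂) < w_face(ε₁)`; `dwLever_of_brackets'` adds `0 < w < 1` for all four weights. Read with
  `dWeight_mem_Icc_node_face` (every Fermi point's weight lies in `[w_node(ε), w_face(ε)]`): the whole certified window slides UP when the Fermi energy is lowered (hole
  doping) and DOWN when it is raised (electron doping) — the one-body «INFL-3to1 by sign of doping» statement of §B.23, per σ set, from two census ε_F brackets and one `decide`.

Sources: three-band model [HybertsenSchluterChristensen1989, Eq. (1)]; [AndersenEtAl1995, §6]; [folklore] algebra.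
-/

noncomputable section

namespace Summit.Ventures.CertifiedManyBodySolver.Downfold.Emery

open Real Set

/-- **THE TWO-ENDED LEVER FROM BRACKETS**: `faceLeverCheck Δ a b c e₁ f₂`, `e₂ < f₁`, `ε₁ ∈ [e₁, e₂]`, `ε₂ ∈ [f₁, f₂]` ⇒ `ε₁ < ε₂ ∧ dWeightNode(ε₂) < dWeightNode(ε₁) ∧
dWeightFace(ε₂) < dWeightFace(ε₁)`. [folklore] -/
theorem dwLever_of_brackets {Δ a b c e₁ e₂ f₁ f₂ : ℚ} (h : faceLeverCheck Δ a b c e₁ f₂ = true) (hgap : e₂ < f₁) {ε₁ ε₂ : ℝ}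
    (h1 : ε₁ ∈ Set.Icc (e₁ : ℝ) e₂) (h2 : ε₂ ∈ Set.Icc (f₁ : ℝ) f₂) :
    ε₁ < ε₂ ∧ dWeightNode (Δ : ℝ) a b c ε₂ < dWeightNode (Δ : ℝ) a b c ε₁ ∧ dWeightFace (Δ : ℝ) a b c ε₂ < dWeightFace (Δ : ℝ) a b c ε₁ := by
  have h' := h
  simp only [faceLeverCheck, Bool.and_eq_true, decide_eq_true_eq] at h'
  obtain ⟨⟨⟨⟨⟨⟨⟨hΔ, hc⟩, hcb⟩, ha⟩, he⟩, -⟩, -⟩, -⟩ := h'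
  have hgap' : (e₂ : ℝ) < f₁ := by exact_mod_cast hgap
  have h12 : ε₁ < ε₂ := lt_of_le_of_lt h1.2 (lt_of_lt_of_le hgap' h2.1)
  have hε₁ : 0 < ε₁ := lt_of_lt_of_le (by exact_mod_cast he) h1.1
  exact ⟨h12, dWeightNode_strictAnti (by exact_mod_cast hΔ) (by exact_mod_cast hc) (by exact_mod_cast hcb) (by exact_mod_cast ha) hε₁ h12,
    dWeightFace_strictAnti_of_check h h1.1 h12 h2.2⟩

/-- The same with the bounds: all four weights lie in `(0, 1)` (`dWeightNode_mem_Ioo`, `dWeightFace_mem_Ioo`; the lower window edge at the energies above `e₁`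
follows from `faceG_mono`). [folklore] -/
theorem dwLever_of_brackets' {Δ a b c e₁ e₂ f₁ f₂ : ℚ} (h : faceLeverCheck Δ a b c e₁ f₂ = true) (hgap : e₂ < f₁) {ε₁ ε₂ : ℝ}
    (h1 : ε₁ ∈ Set.Icc (e₁ : ℝ) e₂) (h2 : ε₂ ∈ Set.Icc (f₁ : ℝ) f₂) :
    dWeightNode (Δ : ℝ) a b c ε₂ ∈ Set.Ioo (0 : ℝ) 1 ∧ dWeightNode (Δ : ℝ) a b c ε₁ ∈ Set.Ioo (0 : ℝ) 1 ∧
      dWeightFace (Δ : ℝ) a b c ε₂ ∈ Set.Ioo (0 : ℝ) 1 ∧ dWeightFace (Δ : ℝ) a b c ε₁ ∈ Set.Ioo (0 : ℝ) 1 := by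
  have h' := h
  simp only [faceLeverCheck, Bool.and_eq_true, decide_eq_true_eq] at h'
  obtain ⟨⟨⟨⟨⟨⟨⟨hΔ, hc⟩, hcb⟩, ha⟩, he⟩, hm⟩, hlo⟩, -⟩ := h'
  have hgap' : (e₂ : ℝ) < f₁ := by exact_mod_cast hgap
  have h12 : ε₁ < ε₂ := lt_of_le_of_lt h1.2 (lt_of_lt_of_le hgap' h2.1)
  have hε₁ : 0 < ε₁ := lt_of_lt_of_le (by exact_mod_cast he) h1.1
  have hε₂ : 0 < ε₂ := hε₁.trans h12
  have hΔ' : (0 : ℝ) < Δ := by exact_mod_cast hΔ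
  have hc' : (0 : ℝ) ≤ c := by exact_mod_cast hc
  have hcb' : (c : ℝ) ≤ b := by exact_mod_cast hcb
  have ha' : (a : ℝ) ≠ 0 := by exact_mod_cast ha
  have hm2 : (c : ℝ) * ε₂ < (a : ℝ) ^ 2 := by
    have : (c : ℝ) * (f₂ : ℝ) < (a : ℝ) ^ 2 := by exact_mod_cast hm
    exact lt_of_le_of_lt (mul_le_mul_of_nonneg_left h2.2 hc') this
  have hm1 : (c : ℝ) * ε₁ < (a : ℝ) ^ 2 := lt_of_le_of_lt (mul_le_mul_of_nonneg_left h12.le hc') hm2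
  have hG1 : 0 ≤ faceG (Δ : ℝ) a c ε₁ := by
    have h0 : 0 ≤ faceG (Δ : ℝ) a c e₁ := by unfold faceG; exact_mod_cast hlo
    exact h0.trans (faceG_mono hΔ'.le hc' (by exact_mod_cast he.le) h1.1)
  have hG2 : 0 ≤ faceG (Δ : ℝ) a c ε₂ := hG1.trans (faceG_mono hΔ'.le hc' hε₁.le h12.le)
  exact ⟨dWeightNode_mem_Ioo hΔ' hc' hcb' hε₂ ha', dWeightNode_mem_Ioo hΔ' hc' hcb' hε₁ ha',
    dWeightFace_mem_Ioo (by linarith) hc' hcb' hε₂ ha' hm2 hG2, dWeightFace_mem_Ioo (by linarith) hc' hcb' hε₁ ha' hm1 hG1⟩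

/-! ## §2 The face window in Fermi-surface language (append 2026-08-30, hubbard-downfold-mod-4 g29; §1 above byte-stable): the lower window edge IS «the contour
reaches the zone face» (`charCubic(1, 0; ε) = (Δ + ε)·faceG(ε)`: `faceG ≥ 0` ⇔ `ε` at or above the `(π, 0)` saddle energy — a HOLE-LIKE Fermi surface), the upper edge IS
«the contour has a zone point at all» (`charCubic(1, 1; ε) = cA − 8fsD − 16fsN ≤ 0` ⇔ `ε` at or below the band top at `(π, π)`) — so the antinodal lever needs nothing beyond
the existence of the antinodal point at the lower energy and of the Fermi surface at the higher one -/

/-- `charCubic(1, 0; ε) = (Δ + ε)·faceG(ε)`: the lower face-window edge `faceG = 0` is the band energy at `(π, 0)` (the saddle point / van Hove level). [folklore] -/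
theorem charCubic_face_zero (Δ tpd tpp c ε : ℝ) : charCubic Δ tpd tpp c 1 0 ε = (Δ + ε) * faceG Δ tpd c ε := by
  unfold charCubic faceG
  ring

/-- `charCubic(1, 1; ε) = cA − 8fsD − 16fsN`: the upper face-window edge is the band energy at `(π, π)` (the top of the antibonding band in the regime). [folklore] -/
theorem charCubic_face_one (Δ tpd tpp c ε : ℝ) : charCubic Δ tpd tpp c 1 1 ε = cA Δ ε - 8 * fsD Δ tpd c ε - 16 * fsN tpd tpp c ε := by
  rw [charCubic_bilinear]
  ring

/-- **A face point of the `ε`-contour inside the zone puts `ε` on or above the lower window edge**: `y ∈ [0, 1]`, `charCubic(1, y; ε) = 0`, `fsD > 0`, `fsN ≥ 0`, `Δ + ε > 0`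
⇒ `0 ≤ faceG(ε)` (indeed `(Δ + ε)·faceG = y·(4fsD + 16fsN)`). [folklore] -/
theorem faceG_nonneg_of_facePoint {Δ tpd tpp c y ε : ℝ} (hE : 0 < Δ + ε) (hD : 0 < fsD Δ tpd c ε) (hN : 0 ≤ fsN tpd tpp c ε) (hy : y ∈ Set.Icc (0 : ℝ) 1)
    (hP : charCubic Δ tpd tpp c 1 y ε = 0) : 0 ≤ faceG Δ tpd c ε := by
  have h : (Δ + ε) * faceG Δ tpd c ε = y * (4 * fsD Δ tpd c ε + 16 * fsN tpd tpp c ε) := by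
    rw [← cA_sub_four_fsD, charCubic_bilinear] at *
    linarith
  have hy' : 0 ≤ y * (4 * fsD Δ tpd c ε + 16 * fsN tpd tpp c ε) := mul_nonneg hy.1 (by positivity)
  rw [← h] at hy'
  exact le_of_mul_le_mul_left (a := Δ + ε) (by rw [mul_zero]; exact hy') hE

/-- **Any zone point of the `ε`-contour puts `ε` on or below the upper window edge**: `x, y ∈ [0, 1]`, `charCubic(x, y; ε) = 0`, `fsD, fsN ≥ 0` ⇒ `cA ≤ 8fsD + 16fsN`
(`cA = 4fsD(x + y) + 16fsN·xy ≤ 8fsD + 16fsN`). [folklore] -/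
theorem faceHi_of_contourPoint {Δ tpd tpp c x y ε : ℝ} (hD : 0 ≤ fsD Δ tpd c ε) (hN : 0 ≤ fsN tpd tpp c ε) (hx : x ∈ Set.Icc (0 : ℝ) 1) (hy : y ∈ Set.Icc (0 : ℝ) 1)
    (hP : charCubic Δ tpd tpp c x y ε = 0) : cA Δ ε ≤ 8 * fsD Δ tpd c ε + 16 * fsN tpd tpp c ε := by
  rw [charCubic_bilinear] at hP
  have h1 : 4 * fsD Δ tpd c ε * (x + y) ≤ 4 * fsD Δ tpd c ε * 2 := mul_le_mul_of_nonneg_left (by linarith [hx.2, hy.2]) (by positivity)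
  have h2 : 16 * fsN tpd tpp c ε * (x * y) ≤ 16 * fsN tpd tpp c ε * 1 :=
    mul_le_mul_of_nonneg_left (by nlinarith [hx.1, hx.2, hy.1, hy.2]) (by positivity)
  linarith

/-- **THE ANTINODAL LEVER IN FERMI-SURFACE LANGUAGE**: in the regime (`Δ > 0`, `0 ≤ t_pp′ ≤ t_pp`, `t_pd ≠ 0`), two Fermi energies `0 < ε₁ < ε₂` with `t_pp′ε₂ < t_pd²`, an
ANTINODAL point `(1, y₁)` of the `ε₁`-surface inside the zone and ANY zone point `(x₂, y₂)` of the `ε₂`-surface ⇒ the antinodal point is THE face point (`y₁ = yFace(ε₁)`), and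
`w_node(ε₂) < w_node(ε₁)`, `w_d(1, y₁; ε₁) = w_face(ε₁) > w_face(ε₂)`: a hole-like Fermi surface only ever becomes MORE Cu-like at both ends when the Fermi energy is lowered.
[folklore] -/
theorem dwLever_of_facePoint {Δ tpd tpp c ε₁ ε₂ y₁ x₂ y₂ : ℝ} (hΔ : 0 < Δ) (hc : 0 ≤ c) (hct : c ≤ tpp) (htpd : tpd ≠ 0) (h1 : 0 < ε₁) (h12 : ε₁ < ε₂)
    (hm : c * ε₂ < tpd ^ 2) (hy₁ : y₁ ∈ Set.Icc (0 : ℝ) 1) (hP₁ : charCubic Δ tpd tpp c 1 y₁ ε₁ = 0)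
    (hx₂ : x₂ ∈ Set.Icc (0 : ℝ) 1) (hy₂ : y₂ ∈ Set.Icc (0 : ℝ) 1) (hP₂ : charCubic Δ tpd tpp c x₂ y₂ ε₂ = 0) :
    y₁ = yFace Δ tpd tpp c ε₁ ∧ dWeightNode Δ tpd tpp c ε₂ < dWeightNode Δ tpd tpp c ε₁ ∧
      dWeightFace Δ tpd tpp c ε₂ < dWeight Δ tpd tpp c 1 y₁ ε₁ := by
  have h2 : 0 < ε₂ := h1.trans h12
  have hm1 : c * ε₁ < tpd ^ 2 := lt_of_le_of_lt (mul_le_mul_of_nonneg_left h12.le hc) hm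
  have hD1 : 0 < fsD Δ tpd c ε₁ := fsD_pos (by linarith) hm1
  have hD2 : 0 < fsD Δ tpd c ε₂ := fsD_pos (by linarith) hm
  have hN1 := fsN_nonneg (tpd := tpd) hc hct h1.le
  have hN2 := fsN_nonneg (tpd := tpd) hc hct h2.le
  have hF1 : 4 * fsD Δ tpd c ε₁ + 16 * fsN tpd tpp c ε₁ ≠ 0 := by positivity
  have hy := eq_yFace_of_face hF1 hP₁
  have hlo := faceG_nonneg_of_facePoint (by linarith) hD1 hN1 hy₁ hP₁
  have hhi := faceHi_of_contourPoint hD2.le hN2 hx₂ hy₂ hP₂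
  refine ⟨hy, dWeightNode_strictAnti hΔ hc hct htpd h1 h12, ?_⟩
  rw [hy]
  exact dWeightFace_strictAnti hΔ hc hct htpd h1 h12 hm hlo hhi

end Summit.Ventures.CertifiedManyBodySolver.Downfold.Emery
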